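import Mathlib
import Literature.AlgebraicGeometry.Resolution.WeightedResolutionDatum
import Summits.ResolutionOfSingularities.ResolutionOfSingularities.Theorems.WeightedInvariantHypersurfaceLocalGameEFT

/-!
# Door line `local-engine` (crux `HypersurfaceCentreConstruction`, stmt-ResolutionOfSingularities-19897):
# H2a‴ `LocalWeightedDropEFT3 p` — the CANONICAL intrinsic e.f.t. local weighted game and its clauses

Definitions only (no claims).  `LocalWeightedDropEFT p` (H2a′, module `…HypersurfaceLocalGameEFT`, p499902) is the bare
intrinsic local game: positions `(S, f)` with `S` a regular local ring essentially of finite type over a perfect field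
of characteristic `p` and `0 ≠ f ∈ 𝔪²`, moves = admissible regular weighted centres on an honest regular system of
parameters, successors = `Localization.AtPrime 𝔫` of the cobordant algebra `extReesAlgebra (weightedMonomialIdeal u w)`
at every prime of the exceptional fibre off the vertex, pay-off = a drop of SOME iso-invariant `ι`.  From the bare
`∃ ι` no global assembly is credible (CRUX-PLAN §v6.8 (A2)); this module types the clauses under which the door's
assembly (res-D-brk-1's `door_assembly_eft3`, sub-stubs [S1]–[S6]) goes through:

* (c6) `IotaIsoInvariant`, (c7) `IotaGenerizationMonotone` (regular local rings only), (c8) `IotaUpperSemicontinuous`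
  (smooth quasi-compact `Y` over a field), (c10) `IotaTorusFactorMonotone`, (c12a) `IotaUnitInvariant` / `JUnitInvariant`
  (equation independence, res-type-025), `JIsoInvariant`, (c11) `IotaJEssSmoothCompatible` (essentially smooth local
  homomorphisms preserve `ι` and extend `J`);
* (c9′) `CanonicalGameClause p ι J`: at every position there is a prime `P ∋ f` with `S ⧸ P` regular (the centre), the
  move is presented on an r.s.p. adapted to `P` with CANONICAL centre filtration `weightedMonomialIdeal u w m = J S f m`
  (the filtration, never the coordinates, is canonical — `weightedMonomialIdeal` is NOT determined by centre and weights,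
  tree specimen `…CentreFiltrationNotDeterminedByCentre`, p500449/p500698), admissible at every prime over `P`, and `ι`
  drops at EVERY prime `𝔫 ∋ t⁻¹` of the cobordant algebra over `P` off the vertex; (c9′-open) `JOpenPresentation`:
  the presentation spreads over an e.f.t. model;
* `LocalWeightedDropEFT3 p := ∃ ι J, all clauses`; `LocalWeightedDropEFTCanonical`, `LocalWeightedDropEFTStrong`
  (intermediate forms kept for the record); seams `eft_of_eft3`, `eft_of_eftStrong` back to H2a′ (sorry-free).

Why it might fail: `p`-th-root cleanings are unavailable over imperfect residue fields; in print the game is won only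
for `dim S ≤ 3` (CJS 2009, CP 2019 non-embedded); a canonical `J` with (c11) is exactly what positive characteristic
has refused so far (kangaroo points defeat the order-based candidates in dimension ≥ 3).  Candidate statements of
plan seat res-L1-w43-plan-1 (eft_sketch v8), criticised by res-L1-w43-strat-1 / idea-2 / tri-2 / res-type-025/039;
OURS, summit-side; AI planning, weaker than expert review.  [L1 W4.3 · door registrar res-L1-w43-plan-1]
-/

set_option linter.dupNamespace false

noncomputable section

open IsLocalRing Literature.AlgebraicGeometry.Resolution

namespace Summit.ResolutionOfSingularities.ResolutionOfSingularities.Cruxes.HypersurfaceCentreConstruction.LocalEngine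

open AlgebraicGeometry CategoryTheory

/-- (c6) `ι` is invariant under ring isomorphisms. -/
def IotaIsoInvariant (ι : (R : Type) → [CommRing R] → R → Ordinal.{0}) : Prop :=
  ∀ (R T : Type) [CommRing R] [CommRing T] (e : R ≃+* T) (g : R), ι T (e g) = ι R g

/-- (c7) `ι` does not increase under generization (localisation at a prime) of a REGULAR local ring (for singular rings
symbolic powers escape ordinary powers, e.g. `x ∈ P⁽²⁾ ∖ 𝔪²` in `k[x,y,z]/(xy - z²)`, `P = (x, z)`; the assembly only
localises the regular stalks `𝒪_{Y,y}` of the smooth ambient `Y`). -/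
def IotaGenerizationMonotone (ι : (R : Type) → [CommRing R] → R → Ordinal.{0}) : Prop :=
  ∀ (S : Type) [CommRing S] [IsRegularLocalRing S] (𝔭 : Ideal S) [𝔭.IsPrime] (f : S),
    ι (Localization.AtPrime 𝔭) (algebraMap S (Localization.AtPrime 𝔭) f) ≤ ι S f

/-- (c8) `ι` is upper semicontinuous along SMOOTH quasi-compact schemes over a field (the door's ambient `Y`; on
singular schemes order-type functions need not be u.s.c., and `ι` is junk on non-regular stalks): every super-level
set of `y ↦ ι 𝒪_{Y,y} f_y` is closed. -/
def IotaUpperSemicontinuous (ι : (R : Type) → [CommRing R] → R → Ordinal.{0}) : Prop :=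
  ∀ (k₀ : Type) [Field k₀] (Y : Scheme.{0}) (hY : Y ⟶ Spec (CommRingCat.of k₀)) [Smooth hY] [QuasiCompact hY]
    (f : Γ(Y, ⊤)) (α : Ordinal.{0}),
    IsClosed {y : ↥Y | α ≤ ι (Y.presheaf.stalk y) (Y.presheaf.germ ⊤ y trivial f)}

/-- (c10) `ι` does not increase when passing from `(S, f)` to the local rings of `S[X]` over the closed point
(the points of `{y} × 𝔾ₘ ⊂ B₋ = (Y ∖ Z) × 𝔾ₘ` replacing a point `y` off the centre under the cobordant blow-up;
res-type-057's (E5)(c) «points off the centre keep ι»). -/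
def IotaTorusFactorMonotone (ι : (R : Type) → [CommRing R] → R → Ordinal.{0}) : Prop :=
  ∀ (S : Type) [CommRing S] [IsRegularLocalRing S] (f : S) (𝔮 : Ideal (Polynomial S)) [𝔮.IsPrime],
    𝔮.comap (Polynomial.C : S →+* Polynomial S) = IsLocalRing.maximalIdeal S →
    ι (Localization.AtPrime 𝔮) (algebraMap (Polynomial S) (Localization.AtPrime 𝔮) (Polynomial.C f)) ≤ ι S f

/-- (c9′) H2a‴ candidate clause — CANONICAL CENTRE FILTRATION (CRUX-PLAN §v6.8 addendum 3): next to `ι` a class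
function `J : (S, f) ↦ (ℕ → Ideal S)`; iso-invariant; at every e.f.t. position the max-`ι` stratum through the closed
point is the regular prime `P`, `J` localises along it, SOME admissible `(u, w)` with `(u_i : w_i > 0) = P` presents
`J(S,f)`, and the successor clause holds over the WHOLE centre germ (`P·B ≤ 𝔫`).  The (open) extendability sub-clause
is NOT yet typed (needs an e.f.t. model; addendum 3).  Candidate for critique only. -/
def CanonicalGameClause (p : ℕ) (ι : (R : Type) → [CommRing R] → R → Ordinal.{0})
    (J : (R : Type) → [CommRing R] → R → ℕ → Ideal R) : Prop :=
  ∀ (k₀ : Type) [Field k₀] [CharP k₀ p] [PerfectField k₀]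
    (S : Type) [CommRing S] [Algebra k₀ S] [Algebra.EssFiniteType k₀ S] [IsRegularLocalRing S]
    (f : S), f ≠ 0 → f ∈ (maximalIdeal S) ^ 2 →
    ∃ (P : Ideal S), P.IsPrime ∧ IsRegularLocalRing (S ⧸ P) ∧ f ∈ P ∧
      -- (strat) `V(P) ∩ V(f)` is exactly the locus of primes where `ι` keeps its closed-point value
      (∀ (𝔭 : Ideal S) [𝔭.IsPrime], f ∈ 𝔭 →
        (ι (Localization.AtPrime 𝔭) (algebraMap S (Localization.AtPrime 𝔭) f) = ι S f ↔ P ≤ 𝔭)) ∧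
      -- (loc) `J` localises along the stratum
      (∀ (𝔭 : Ideal S) [𝔭.IsPrime], f ∈ 𝔭 → P ≤ 𝔭 → ∀ m : ℕ,
        J (Localization.AtPrime 𝔭) (algebraMap S (Localization.AtPrime 𝔭) f) m =
          (J S f m).map (algebraMap S (Localization.AtPrime 𝔭))) ∧
      -- (pres) + (adm) + (drop over the whole centre germ)
      ∃ (n : ℕ) (u : Fin n → S) (w : Fin n → ℕ),
        Ideal.span (Set.range u) = maximalIdeal S ∧ (maximalIdeal S).spanFinrank = n ∧ (∃ i, 0 < w i) ∧
        Ideal.span {x | ∃ i, 0 < w i ∧ x = u i} = P ∧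
        (∀ m : ℕ, weightedMonomialIdeal u w m = J S f m) ∧
        (∀ (Q : Ideal S) [Q.IsPrime], P ≤ Q →
          algebraMap S (Localization.AtPrime Q) f ∈ (maximalIdeal (Localization.AtPrime Q)) ^ 2) ∧
        ∀ (𝔫 : Ideal (cobordantAlgebra' u w)) [𝔫.IsPrime],
          cobordantT' u w ∈ 𝔫 →
          P.map (algebraMap S (cobordantAlgebra' u w)) ≤ 𝔫 →
          ¬ (extReesAlgebra.vertexIdeal (weightedMonomialIdeal u w) ≤ 𝔫) →
          ∀ (a : ℕ) (g : cobordantAlgebra' u w),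
            algebraMap S (cobordantAlgebra' u w) f = cobordantT' u w ^ a * g →
            ¬ (cobordantT' u w ∣ g) →
            algebraMap (cobordantAlgebra' u w) (Localization.AtPrime 𝔫) g ∈
              (maximalIdeal (Localization.AtPrime 𝔫)) ^ 2 →
            ι (Localization.AtPrime 𝔫) (algebraMap (cobordantAlgebra' u w) (Localization.AtPrime 𝔫) g) < ι S f

/-- (c9′-open) OPEN EXTENDABILITY of the canonical centre filtration `J` on an e.f.t. MODEL: every e.f.t. position
`(S, f)` has a finite-type model `(A, 𝔪, F)` (`A_𝔪 ≃ S`, `F ↦ f`) and ONE weighted system `(U, W)` on `A` which presents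
`J` at EVERY prime `𝔮` of a basic open neighbourhood `D(h) ∋ 𝔪` lying on the max-`ι` stratum (`F ∈ 𝔮`, same `ι`-value)
— this is what makes `y ↦ J(𝒪_{Y,y}, f_y)` the stalks of one quasi-coherent Rees algebra near the stratum.  Candidate. -/
def JOpenPresentation (p : ℕ) (ι : (R : Type) → [CommRing R] → R → Ordinal.{0})
    (J : (R : Type) → [CommRing R] → R → ℕ → Ideal R) : Prop :=
  ∀ (k₀ : Type) [Field k₀] [CharP k₀ p] [PerfectField k₀]
    (S : Type) [CommRing S] [Algebra k₀ S] [Algebra.EssFiniteType k₀ S] [IsRegularLocalRing S]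
    (f : S), f ≠ 0 → f ∈ (maximalIdeal S) ^ 2 →
    ∃ (A : Type) (_ : CommRing A) (_ : Algebra k₀ A) (_ : Algebra.FiniteType k₀ A) (𝔪 : Ideal A) (_ : 𝔪.IsPrime)
      (e : Localization.AtPrime 𝔪 ≃+* S) (F : A),
      e (algebraMap A (Localization.AtPrime 𝔪) F) = f ∧
      ∃ (h : A), h ∉ 𝔪 ∧ ∃ (N : ℕ) (U : Fin N → A) (W : Fin N → ℕ),
        ∀ (𝔮 : Ideal A) [𝔮.IsPrime], h ∉ 𝔮 → F ∈ 𝔮 →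
          ι (Localization.AtPrime 𝔮) (algebraMap A (Localization.AtPrime 𝔮) F) = ι S f →
          ∀ m : ℕ, J (Localization.AtPrime 𝔮) (algebraMap A (Localization.AtPrime 𝔮) F) m =
            (weightedMonomialIdeal U W m).map (algebraMap A (Localization.AtPrime 𝔮))

/-- (c11) (stub-9 = res-D-brk-1 CRITIC (E6) 05:14:26Z, TYPING POINT 1) `ι` and `J` are compatible with ESSENTIALLY SMOOTH
LOCAL homomorphisms of regular local rings (`S → S'` local, formally smooth, essentially of finite type): `ι` is preserved
and `J` extends.  Needed for the torus-homogeneity (hom) of the glued global centre over FINITE perfect fields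
(𝔾ₘ(𝔽_p)-stability ≠ homogeneity); subsumes (c10); true for every order/differential-operator-built `(ι, J)`. -/
def IotaJEssSmoothCompatible (ι : (R : Type) → [CommRing R] → R → Ordinal.{0})
    (J : (R : Type) → [CommRing R] → R → ℕ → Ideal R) : Prop :=
  ∀ (S S' : Type) [CommRing S] [CommRing S'] [IsRegularLocalRing S] [IsRegularLocalRing S'] [Algebra S S']
    [IsLocalHom (algebraMap S S')] [Algebra.FormallySmooth S S'] [Algebra.EssFiniteType S S'] (f : S),
    ι S' (algebraMap S S' f) = ι S f ∧ ∀ m : ℕ, J S' (algebraMap S S' f) m = (J S f m).map (algebraMap S S')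

/-- `J` is transported by ring isomorphisms. -/
def JIsoInvariant (J : (R : Type) → [CommRing R] → R → ℕ → Ideal R) : Prop :=
  ∀ (R T : Type) [CommRing R] [CommRing T] (e : R ≃+* T) (g : R) (m : ℕ), J T (e g) m = (J R g m).map e

/-- (c12a) UNIT INVARIANCE of `ι` (res-type-025 CRITIC (c12) «equation independence», 2026-08-27T05:19:26Z; registrar
ruling TP4): two local equations of a locally principal hypersurface differ by a unit, so the global functions `y ↦ ι(𝒪_{Y,y}, f_y)`
([S1]) must not depend on the chosen equation.  Every intended `ι` (order, Diff-built, Hilbert–Samuel) depends on the ideal `(f)` only.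
At the bare H2a′ level this clause is free (replace `ι` by `f ↦ ⨅ u unit, ι (u f)`); for the assembly it must be explicit. -/
def IotaUnitInvariant (ι : (R : Type) → [CommRing R] → R → Ordinal.{0}) : Prop :=
  ∀ (R : Type) [CommRing R] (v g : R), IsUnit v → ι R (v * g) = ι R g

/-- (c12a) UNIT INVARIANCE of the centre filtration `J` (same source; needed for the global Rees algebra of [S3] and for [S5]). -/
def JUnitInvariant (J : (R : Type) → [CommRing R] → R → ℕ → Ideal R) : Prop :=
  ∀ (R : Type) [CommRing R] (v g : R) (m : ℕ), IsUnit v → J R (v * g) m = J R g m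

/-- (c9′) alone, as first typed (addendum 4): `∃ ι J`, iso clauses and the canonical game clause. -/
@[conjecture] def LocalWeightedDropEFTCanonical (p : ℕ) : Prop :=
  ∃ (ι : (R : Type) → [CommRing R] → R → Ordinal.{0}) (J : (R : Type) → [CommRing R] → R → ℕ → Ideal R),
  IotaIsoInvariant ι ∧ JIsoInvariant J ∧ CanonicalGameClause p ι J

/-- **H2a‴ candidate** (CRUX-PLAN §v6.8 addenda 3–5): ONE pair `(ι, J)` carrying every clause the assembly census
asks for — (c6) iso-invariance, (c7) generisation-monotonicity, (c8) upper semicontinuity on schemes locally of finite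
type over a field, (c10) torus-factor monotonicity, (c11) essentially-smooth compatibility of `(ι, J)`, (c9′) the canonical admissible game clause with drop over the whole
centre germ, (c9′-open) open presentation on an e.f.t. model.  Implies H2a′ is NOT claimed here (the game clause of
(c9′) quantifies successors over `P·B ≤ 𝔫` ⊇ those over `𝔪·B ≤ 𝔫`, so it does imply the H2a′ successor clause; the
seam is for a prover).  Candidate for critique; v3 door-skeleton material. -/
@[conjecture] def LocalWeightedDropEFT3 (p : ℕ) : Prop :=
  ∃ (ι : (R : Type) → [CommRing R] → R → Ordinal.{0}) (J : (R : Type) → [CommRing R] → R → ℕ → Ideal R),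
  IotaIsoInvariant ι ∧ IotaGenerizationMonotone ι ∧ IotaUpperSemicontinuous ι ∧ IotaTorusFactorMonotone ι ∧
  JIsoInvariant J ∧ IotaJEssSmoothCompatible ι J ∧ CanonicalGameClause p ι J ∧ JOpenPresentation p ι J ∧
  IotaUnitInvariant ι ∧ JUnitInvariant J

/-- H2a″ candidate: H2a′ with the clauses (c7), (c8) on `ι` (same game clause, verbatim); (c10) is stated separately
(`IotaTorusFactorMonotone`) and (c9) is prose (CRUX-PLAN §v6.8). -/
@[conjecture] def LocalWeightedDropEFTStrong (p : ℕ) : Prop :=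
  ∃ ι : (R : Type) → [CommRing R] → R → Ordinal.{0},
  IotaGenerizationMonotone ι ∧ IotaUpperSemicontinuous ι ∧
  (∀ (R T : Type) [CommRing R] [CommRing T] (e : R ≃+* T) (g : R), ι T (e g) = ι R g) ∧
  ∀ (k₀ : Type) [Field k₀] [CharP k₀ p] [PerfectField k₀]
    (S : Type) [CommRing S] [Algebra k₀ S] [Algebra.EssFiniteType k₀ S] [IsRegularLocalRing S]
    (f : S), f ≠ 0 → f ∈ (maximalIdeal S) ^ 2 →
    ∃ (n : ℕ) (u : Fin n → S) (w : Fin n → ℕ),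
      Ideal.span (Set.range u) = maximalIdeal S ∧ (maximalIdeal S).spanFinrank = n ∧ (∃ i, 0 < w i) ∧
      (∀ (P : Ideal S) [P.IsPrime], (∀ i, 0 < w i → u i ∈ P) →
        algebraMap S (Localization.AtPrime P) f ∈ (maximalIdeal (Localization.AtPrime P)) ^ 2) ∧
      ∀ (𝔫 : Ideal (cobordantAlgebra' u w)) [𝔫.IsPrime],
        cobordantT' u w ∈ 𝔫 →
        (maximalIdeal S).map (algebraMap S (cobordantAlgebra' u w)) ≤ 𝔫 →
        ¬ (extReesAlgebra.vertexIdeal (weightedMonomialIdeal u w) ≤ 𝔫) →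
        ∀ (a : ℕ) (g : cobordantAlgebra' u w),
          algebraMap S (cobordantAlgebra' u w) f = cobordantT' u w ^ a * g →
          ¬ (cobordantT' u w ∣ g) →
          algebraMap (cobordantAlgebra' u w) (Localization.AtPrime 𝔫) g ∈
            (maximalIdeal (Localization.AtPrime 𝔫)) ^ 2 →
          ι (Localization.AtPrime 𝔫) (algebraMap (cobordantAlgebra' u w) (Localization.AtPrime 𝔫) g) < ι S f

/-- Glue back to the registered H2a′ (one line: drop the two extra clauses). -/
theorem eft_of_eftStrong (p : ℕ) : LocalWeightedDropEFTStrong p → LocalWeightedDropEFT p := by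
  rintro ⟨ι, -, -, hiso, hgame⟩
  exact ⟨ι, hiso, hgame⟩

/-- Seam: H2a‴ implies H2a′ (successors over `𝔪·B` are among those over `P·B` since `P ≤ 𝔪`; admissibility at primes
containing the positively weighted parameters follows from `span = P`). -/
theorem eft_of_eft3 (p : ℕ) : LocalWeightedDropEFT3 p → LocalWeightedDropEFT p := by
  rintro ⟨ι, J, hiso, -, -, -, -, -, hgame, -, -, -⟩
  refine ⟨ι, hiso, ?_⟩
  intro k₀ _ _ _ S _ _ _ _ f hf0 hf2
  obtain ⟨P, hP, -, -, -, -, n, u, w, hspan, hrk, hpos, hctr, -, hadm, hsucc⟩ :=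
    hgame k₀ S f hf0 hf2
  refine ⟨n, u, w, hspan, hrk, hpos, ?_, ?_⟩
  · intro P' _ hP'
    haveI := hP
    have hle : P ≤ P' := by
      rw [← hctr]
      apply Ideal.span_le.mpr
      rintro x ⟨i, hi, rfl⟩
      exact hP' i hi
    exact hadm P' hle
  · intro 𝔫 _ ht hm hv a g hfg hndvd hsing
    haveI := hP
    have hPm : P ≤ maximalIdeal S := IsLocalRing.le_maximalIdeal hP.ne_top
    exact hsucc 𝔫 ht ((Ideal.map_mono hPm).trans hm) hv a g hfg hndvd hsing

end Summit.ResolutionOfSingularities.ResolutionOfSingularities.Cruxes.HypersurfaceCentreConstruction.LocalEngine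

end
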